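import Summits.ResolutionOfSingularities.ResolutionOfSingularities.Theorems.FrobeniusLadderFInjectiveMacaulayficationPinchStrictTransform
import HarnessLib

/-!
# (T-I3, habitat #3a centre side, part 3) THE SINGULAR LOCUS OF THE PINCH MODEL `C = Λ[x′, y]/(x′² + y²·g)` IS EXACTLY `V(J)`, `J = (x′, y)·C`
# (crux `FInjectiveMacaulayfication` stmt-ResolutionOfSingularities-15315, chain w45a; `Lines/T-I3-firststep.md` §3 #3a; seat res-L1-w45a-lead-1 g11)

[OURS · L1 W4.5a] Support file (`--supports stmt-ResolutionOfSingularities-15315 --as helper`); def-free; UNCONDITIONAL; no named fact; NOT a statement of any manuscript. Commutative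
algebra; with ✓/⧗ `PinchStrictTransform.isRegular_affineBlowup_pinch` it says: blowing up the (reduced) singular locus of the pinch model regularises it — the centre `J` is
the whole `V(x′, y)` (codimension ONE in `Spec C`, the non-normal locus), whatever `g` is. Evidence for nothing beyond itself; T″ and the F-half OPEN; nothing of the crux proved.
AI-written (AI review is weaker than expert review).

* `h_mem_sq` (`h ∈ I²`), `h_ne_zero` (`Λ` nontrivial: the coefficient of `x′²`), ★ `not_isRegularLocalRing_of_le` (`P ⊇ J ⇒ C_P` singular; Matsumura 14.2),
  ★ `map_le_of_not_isRegularLocalRing` (`C_P` singular ⇒ `P ⊇ J`: `2x′ = ∂_{x′}h ∈ 𝔓`; `2y·g = ∂_y h ∈ 𝔓` gives `y ∈ 𝔓` or `g ∈ 𝔓 ∩ Λ`, and in the latter case the coefficientwise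
  extension of a `D` with `D g ∉ 𝔓 ∩ Λ` has `D̃h = y²·C(Dg) ∈ 𝔓`, so again `y ∈ 𝔓`; `Λ` regular ∋ ½, pointwise derivations on `V(g)`), ★★ `not_isRegularLocalRing_iff_map_le`.
[cite: StacksProject, Tag 07PF] [cite: Matsumura1987, Thm. 14.2]
-/

-- single-problem summit: the doubled namespace component is forced
set_option linter.dupNamespace false

noncomputable section

namespace Summit.ResolutionOfSingularities.ResolutionOfSingularities.Theorems.FInjectiveMacaulayfication.PinchSingularLocus

open MvPolynomial Literature.AlgebraicGeometry.Resolution AlgebraicGeometry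
open Summit.ResolutionOfSingularities.ResolutionOfSingularities.Theorems.FInjectiveMacaulayfication
open PinchStrictTransform

universe u v

variable {Λ : Type u} [CommRing Λ] (g : Λ) (cen : Fin 2 → MvPolynomial (Fin 2) Λ) (h : MvPolynomial (Fin 2) Λ)

/-- `h ∈ I²`. [folklore] -/
theorem h_mem_sq (hcen : cen = ![X 0, X 1]) (hh : h = X 0 ^ 2 + X 1 ^ 2 * C g) : h ∈ Ideal.span (Set.range cen) ^ 2 := by
  obtain ⟨h0, h1⟩ := cen_apply cen hcen
  have hm : ∀ j, cen j ∈ Ideal.span (Set.range cen) := fun j => Ideal.subset_span ⟨j, rfl⟩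
  rw [hh, pow_two, pow_two, pow_two, ← h0, ← h1]
  exact Ideal.add_mem _ (Ideal.mul_mem_mul (hm 0) (hm 0)) (Ideal.mul_mem_right _ _ (Ideal.mul_mem_mul (hm 1) (hm 1)))

/-- `h ≠ 0` over a nontrivial `Λ` (evaluate at `x′ = 1`, `y = 0`). [plumbing] -/
theorem h_ne_zero [Nontrivial Λ] (hh : h = X 0 ^ 2 + X 1 ^ 2 * C g) : h ≠ 0 := by
  have hev : MvPolynomial.eval ![(1 : Λ), 0] h = 1 := by
    rw [hh]
    simp only [map_add, map_mul, map_pow, eval_X, eval_C, Matrix.cons_val_zero, Matrix.cons_val_one]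
    simp
  intro h0
  rw [h0, map_zero] at hev
  exact zero_ne_one hev

/-- ★ **Every point of `V(J) ⊂ Spec C` is singular** (`Λ` a regular domain): `0 ≠ h ∈ I² ⊆ 𝔓²`. [cite: Matsumura1987, Thm. 14.2] -/
theorem not_isRegularLocalRing_of_le [IsRegularRing Λ] [IsDomain Λ] (hcen : cen = ![X 0, X 1]) (hh : h = X 0 ^ 2 + X 1 ^ 2 * C g)
    (P : Ideal (MvPolynomial (Fin 2) Λ ⧸ Ideal.span {h})) [P.IsPrime]
    (hP : (Ideal.span (Set.range cen)).map (Ideal.Quotient.mk (Ideal.span {h})) ≤ P) :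
    ¬ IsRegularLocalRing (Localization.AtPrime P) := by
  refine not_isRegularLocalRing_localization_quotient_of_mem_sq (h_ne_zero g h hh) P ?_
  have hle : Ideal.span (Set.range cen) ≤ P.comap (Ideal.Quotient.mk (Ideal.span {h})) := by
    rw [← Ideal.map_le_iff_le_comap]; exact hP
  exact Ideal.pow_right_mono hle 2 (h_mem_sq g cen h hcen hh)

/-- `∂_{T₁} h = 2T₁·C g`. [plumbing] -/
theorem pderiv_one_h (hh : h = X 0 ^ 2 + X 1 ^ 2 * C g) :
    (pderiv 1 : Derivation Λ (MvPolynomial (Fin 2) Λ) (MvPolynomial (Fin 2) Λ)) h = 2 * X 1 * C g := by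
  subst hh
  simp only [map_add, Derivation.leibniz, Derivation.leibniz_pow, pderiv_X_self, pderiv_X_of_ne (show (0 : Fin 2) ≠ 1 by decide), pderiv_C, smul_zero,
    zero_add, smul_eq_mul, mul_one, nsmul_eq_mul, mul_zero]
  push_cast; ring

/-- ★ **A singular point of `C = R/(h)` contains `J`** (`Λ` regular ∋ ½, pointwise derivations on `V(g)`): see the file header. [cite: StacksProject, Tag 07PF] -/
theorem map_le_of_not_isRegularLocalRing [IsRegularRing Λ] (h2 : IsUnit (2 : Λ)) {S₀ : Type v} [CommRing S₀] [Algebra S₀ Λ]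
    (hD : ∀ Q : Ideal Λ, Q.IsPrime → g ∈ Q → ∃ D : Derivation S₀ Λ Λ, D g ∉ Q) (hcen : cen = ![X 0, X 1]) (hh : h = X 0 ^ 2 + X 1 ^ 2 * C g)
    (P : Ideal (MvPolynomial (Fin 2) Λ ⧸ Ideal.span {h})) [P.IsPrime] (hP : ¬ IsRegularLocalRing (Localization.AtPrime P)) :
    (Ideal.span (Set.range cen)).map (Ideal.Quotient.mk (Ideal.span {h})) ≤ P := by
  obtain ⟨h0, h1⟩ := cen_apply cen hcen
  haveI hp : (P.comap (Ideal.Quotient.mk (Ideal.span {h}))).IsPrime := Ideal.comap_isPrime _ P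
  have hu2 : IsUnit (2 : MvPolynomial (Fin 2) Λ) := by
    rw [show (2 : MvPolynomial (Fin 2) Λ) = C (2 : Λ) by rw [map_ofNat]]; exact h2.map C
  have h2nm : (2 : MvPolynomial (Fin 2) Λ) ∉ P.comap (Ideal.Quotient.mk (Ideal.span {h})) := fun hm => hp.ne_top (Ideal.eq_top_of_isUnit_mem _ hm hu2)
  -- `x′ ∈ 𝔓`
  have hX0 : (X 0 : MvPolynomial (Fin 2) Λ) ∈ P.comap (Ideal.Quotient.mk (Ideal.span {h})) := by
    have := Derivation.apply_mem_comap_of_not_isRegularLocalRing (pderiv 0 : Derivation Λ (MvPolynomial (Fin 2) Λ) (MvPolynomial (Fin 2) Λ)) h P hP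
    rw [pderiv_zero_h g h hh] at this
    exact (hp.mem_or_mem this).resolve_left h2nm
  -- `y ∈ 𝔓`
  have hX1 : (X 1 : MvPolynomial (Fin 2) Λ) ∈ P.comap (Ideal.Quotient.mk (Ideal.span {h})) := by
    have hy := Derivation.apply_mem_comap_of_not_isRegularLocalRing (pderiv 1 : Derivation Λ (MvPolynomial (Fin 2) Λ) (MvPolynomial (Fin 2) Λ)) h P hP
    rw [pderiv_one_h g h hh] at hy
    rcases hp.mem_or_mem hy with h2y | hCg
    · exact (hp.mem_or_mem h2y).resolve_left h2nm
    · -- `g ∈ 𝔓 ∩ Λ`: a derivation `D` with `D g ∉ 𝔓 ∩ Λ` has `D̃ h = y²·C(D g) ∈ 𝔓`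
      haveI : ((P.comap (Ideal.Quotient.mk (Ideal.span {h}))).comap (C : Λ →+* MvPolynomial (Fin 2) Λ)).IsPrime := Ideal.comap_isPrime _ _
      obtain ⟨D, hDg⟩ := hD ((P.comap (Ideal.Quotient.mk (Ideal.span {h}))).comap (C : Λ →+* MvPolynomial (Fin 2) Λ)) inferInstance
        (by rw [Ideal.mem_comap]; exact hCg)
      have hw := Derivation.apply_mem_comap_of_not_isRegularLocalRing (coeffwiseDerivation (ι := Fin 2) D) h P hP
      rw [coeffwiseDerivation_h g h D hh] at hw
      rcases hp.mem_or_mem hw with hy2 | hDg'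
      · exact hp.mem_of_pow_mem 2 hy2
      · exact absurd (by rw [Ideal.mem_comap]; exact hDg') hDg
  rw [Ideal.map_le_iff_le_comap, Ideal.span_le]
  rintro _ ⟨j, rfl⟩
  fin_cases j
  · exact h0 ▸ hX0
  · exact h1 ▸ hX1

/-- ★★ **`Sing(Spec C) = V(J)` for the pinch model** (`Λ` a regular domain ∋ ½, pointwise derivations on `V(g)`): a prime `P` of `C = Λ[x′, y]/(x′² + y²g)` is a SINGULAR point iff
`P ⊇ J = (x′, y)·C`. With `PinchStrictTransform.isRegular_affineBlowup_pinch`: blowing up the reduced singular locus regularises. [cite: StacksProject, Tag 07PF] [cite: Matsumura1987, Thm. 14.2] -/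
theorem not_isRegularLocalRing_iff_map_le [IsRegularRing Λ] [IsDomain Λ] (h2 : IsUnit (2 : Λ)) {S₀ : Type v} [CommRing S₀] [Algebra S₀ Λ]
    (hD : ∀ Q : Ideal Λ, Q.IsPrime → g ∈ Q → ∃ D : Derivation S₀ Λ Λ, D g ∉ Q) (hcen : cen = ![X 0, X 1]) (hh : h = X 0 ^ 2 + X 1 ^ 2 * C g)
    (P : Ideal (MvPolynomial (Fin 2) Λ ⧸ Ideal.span {h})) [P.IsPrime] :
    ¬ IsRegularLocalRing (Localization.AtPrime P) ↔ (Ideal.span (Set.range cen)).map (Ideal.Quotient.mk (Ideal.span {h})) ≤ P :=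
  ⟨map_le_of_not_isRegularLocalRing g cen h h2 hD hcen hh P, not_isRegularLocalRing_of_le g cen h hcen hh P⟩

end Summit.ResolutionOfSingularities.ResolutionOfSingularities.Theorems.FInjectiveMacaulayfication.PinchSingularLocus

end
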